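import Summits.QuantumFields.YangMills.Theorems.BalabanUVNodesN17ShiftModulusCrossoverSharp

/-!
# NODE N17 → THE N19′ CROSSOVER — FILE 8 of the shift-modulus lineage: THE PRICE OF A NON-GEOMETRIC N17 LETTER, IN NUMBERS
# (FILE 4's sharp threshold at POLYNOMIAL moduli and at `T4Crossover`'s own bases: `σ⋆ = β ∕ (4 + β)`)

Cell `pub-ymgap` (HUMAN RULINGS D-0062 Track A ∕ D-0149), WIDTH SEAT `pub-ymgap-dag-n17-w2` (generation 6), CLAIM-1 ∕ INTENT-1 (INBOX l.37198; self-located under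
START-LIST §0 (iii)).  Key K3⁸ stmt-QuantumFields-27366 `SpineGivenEndpointR13SepCoPHV` (`--kind proof --supports stmt-QuantumFields-27366 --as helper`, COUNT-NEUTRAL).
Continues THIS lineage's FILE 1 p597419 `…N17ShiftModulusCrossover` (node N17 reaches K3's N19′ face ONLY through node U2's injected rate and `T4Crossover`'s crossover
`K ↦ Σ_{j+n=K} min(aⁿ, r_j Λⁿ)` — old-scale contraction `a = L^{−β}`, multiplicity base `Λ = L⁴` ([Balaban1987RG1] (0.26) p. 257), FILE 1's located reading of
`N19CoreKnit.core_summable_of_spineNodes`), FILE 2 p598022 `…CrossoverU2` (injected modulus = TAILS of the full-β shift modulus; `tails_inv_sq_not_rpowSummable`) and FILE 4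
p601212 `…CrossoverSharp` (★★ `summable_crossover_iff_rpowSummable_threshold`: in the regime `0 < a < 1 < Λ`, for `0 ≤ r ≤ 1`, the crossover is summable IFF
`Σ_j r_j^{σ⋆} < ∞`, `σ⋆ = log(1∕a) ∕ log(Λ∕a) ∈ ]0, 1[`).

WHY NOW — the ym-nodeO critics' **F-E finding** (IDEA-1 g12 located, CRIT-1 g5 confirmed, CRIT-2 g3 E-CRIT2-2 ∕ BN-N, CRIT-1 g6 cross-read
`Cruxes/EndpointGivenBR13SepCoPH/CRIT-1-CROSSREAD-E-CRIT2-2-geometric-letters.md`): modulo H_FE′ (NODE 00's free-history β of record FIRST-ENTRY-ONLY) + the transport reading (T),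
the GEOMETRIC box letters `ScaleShiftRate` (node N17's `N17At`, the N17 conjunct of `stub_rates13HV`) and `FadingMemory` are presumptively FALSE at the current record, while RUN
letters survive; dag-n17-w1 g6 FILE 6 p627997 `…N17TwoRunShift` ∕ FILE 7 `…N17TwoRunShiftFirstEntry` type the N17 side: under (T) the infrared-matched two-run letter IS pv16's
Markov scale shift at the realised coupling, and DEF-1's run letters (K1⁹ ∕ K2⁹ currency) need it only SUMMABLE.  THE K3 SIDE ASKS MORE, and this file says HOW MUCH: whatever
non-geometric modulus `r` a post-F-E N17 letter injects into node U2, the N19′ face of `stub_expansion13HV` fed through the crossover needs `r ∈ ℓ^{σ⋆}` (FILE 4), and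
§1 `σ⋆ = β ∕ (κ + β)` at power bases `a = L^{−β}`, `Λ = L^κ` (`threshold_rpow_bases`); at `T4Crossover`'s `κ = 4`: `σ⋆ = β ∕ (4 + β)` (`threshold_T4_bases`), inside `]1∕7, 1∕5[` on the
   Hölder window `β ∈ ]2∕3, 1[` (`threshold_T4_window`);
§2 POLYNOMIAL MODULI `r_j = (j+1)^{−m}`: `Σ ((j+1)^{−m})^σ < ∞ ⟺ 1 < m·σ` (`rpowSummable_polyModulus_iff`, Mathlib's p-series), hence ★ `summable_crossover_polyModulus_iff`
   (crossover summable ⟺ `1 < m·σ⋆`); `not_summable_crossover_harmonic` (m = 1: NEVER, since `σ⋆ < 1`); `summable_crossover_invSq_iff` (m = 2: ⟺ `a·Λ < 1`);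
   comparison forms `not_summable_crossover_of_polyLower` (`c·(j+1)^{−m} ≤ r_j ≤ 1`, `c > 0`, `m·σ⋆ ≤ 1` ⟹ NOT summable) ∕ `summable_crossover_of_polyUpper`
   (`0 ≤ r_j ≤ C·(j+1)^{−m}`, `1 < m·σ⋆` ⟹ summable);
§3 AT `T4Crossover`'s BASES: ★★ `summable_crossover_polyModulus_T4_iff` — `r_j = (j+1)^{−m}` survives ⟺ `(4 + β) ∕ β < m` (a decay FASTER than `k^{−(4+β)∕β}`, exponent in `]5, 7[`
   on the Hölder window); `not_summable_crossover_T4_of_le_five` (`m ≤ 5`, `β < 1` ⟹ NOT); `not_summable_crossover_T4_invSq` (m = 2 ⟹ NOT: `a·Λ = L^{4−β} > 1`);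
   `aΛ_T4_gt_one`.
READING (located, for the plan's F-E re-key of K3⁸ and CRIT-2's BN-N; nothing asserted of the record): IF F-E leaves node N17 with only a summable or polynomially decaying
(Markov ∕ two-run) scale shift, then K3⁸'s N19′ face CANNOT be fed through node U2's injected rate unless that modulus decays faster than `k^{−(4+β)∕β}` (> `k⁻⁵`); a marginal
`1∕k` or `1∕k²` modulus (CRIT-2's transport toy oscillates by `≍ 1∕k`, FILE 7 `not_scaleShiftRate_transportToy`) fails by a wide margin — the N19′ junction then needs a road
NOT through node U2's crossover, or a geometric letter recovered in RUN currency.  By FILE 2 the injected modulus is the TAIL of the shift modulus, so the demand on the shift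
modulus itself is one power stronger.

HONEST SCOPE (A6, director-ym №189).  Elementary real analysis ([folklore]: logarithms, `Real.rpow`, Mathlib's p-series `Real.summable_nat_rpow_inv`) over `T4Crossover`'s
antidiagonal SHAPE and FILE 4 BY NAME; `a = L^{−β}`, `Λ = L⁴` is FILE 1's located reading of the N19′ knit, cited not re-derived; whether H_FE′ ∕ (T) hold at NODE 00's record and
what rate the surviving run letter has is node00-def ∕ the critics' ∕ dag-n17-w1's business — NOTHING of Bałaban is asserted or instantiated; NE4 NOT IN PRINT ([Balaban1987RG1]
p. 264 «We will investigate other properties in a separate paper») and NOT proved in any keying; NOT a proof of `stub_rates13HV` ∕ `stub_expansion13HV`; N17 NOT discharged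
(DEPENDENT∕DERIVED row); K0⁷ ∕ K1⁹ ∕ K3⁸ OPEN; counts UNMOVED (typed 28∕28 · discharged 5∕28).  One finite four-torus programme at fixed `ε = L^{−K}`, Bałaban AS PRINTED; the
YM mass gap (Clay) is NOT proved by any of this — R4 closes the conditional finite-𝕋⁴ rung `BalabanLadder.UV` only; nothing continuum ∕ ℝ⁴ ∕ OS.  0 `def`, 0 `instance`,
0 `notation`, 0 `sorry`; standard axioms.
[Balaban1987RG1] T. Bałaban, Renormalization group approach to lattice gauge field theories. I, CMP **109** (1987): (0.26) p. 257, Thm 2 p. 259, (1.20)–(1.22) p. 264, §5 p. 298.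
-/

noncomputable section

namespace Summit.QuantumFields.YangMills.BalabanUVNodes.N17ShiftModulusCrossoverPolynomial

open Summit.QuantumFields.YangMills.BalabanUVNodes.N17ShiftModulusCrossover (threshold_pos threshold_lt_one)
open Summit.QuantumFields.YangMills.BalabanUVNodes.N17ShiftModulusCrossoverSharp
  (summable_crossover_iff_rpowSummable_threshold not_summable_crossover_of_not_rpowSummable_threshold summable_crossover_at_threshold)
open Finset

/-! ## §1 The threshold exponent at power bases: `σ⋆ = β ∕ (κ + β)`; at `T4Crossover`'s bases `β ∕ (4 + β) ∈ ]1∕7, 1∕5[` -/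

/-- AT POWER BASES `a = L^{−β}` (contraction), `Λ = L^κ` (multiplicity), `L > 1` (any real `β, κ`; meaningful for `β, κ > 0`), the transport threshold is `σ⋆ = log(1∕a)∕log(Λ∕a) = β ∕ (κ + β)`. [folklore] -/
theorem threshold_rpow_bases {L : ℝ} (β κ : ℝ) (hL : 1 < L) :
    Real.log (1 / L ^ (-β)) / Real.log (L ^ κ / L ^ (-β)) = β / (κ + β) := by
  have hL0 : 0 < L := one_pos.trans hL
  have hlogL : 0 < Real.log L := Real.log_pos hL
  have h1 : 1 / L ^ (-β) = L ^ β := by rw [Real.rpow_neg hL0.le, one_div, inv_inv]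
  have h2 : L ^ κ / L ^ (-β) = L ^ (κ + β) := by rw [Real.rpow_neg hL0.le, div_inv_eq_mul, ← Real.rpow_add hL0]
  rw [h1, h2, Real.log_rpow hL0, Real.log_rpow hL0, mul_div_mul_right _ _ hlogL.ne']

/-- AT `T4Crossover`'s BASES (`a = L^{−β}` old-scale contraction, `Λ = L⁴` = the multiplicity of scale-`j` domains, [Balaban1987RG1] (0.26) p. 257; FILE 1's reading of the
N19′ knit): `σ⋆ = β ∕ (4 + β)`. [cite: Balaban1987RG1, (0.26) p.257] -/
theorem threshold_T4_bases {L : ℝ} (β : ℝ) (hL : 1 < L) :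
    Real.log (1 / L ^ (-β)) / Real.log (L ^ (4 : ℕ) / L ^ (-β)) = β / (4 + β) := by
  have h := threshold_rpow_bases β 4 hL
  rwa [show (L : ℝ) ^ (4 : ℝ) = L ^ (4 : ℕ) by exact_mod_cast Real.rpow_natCast L 4] at h

/-- on the Hölder window `β ∈ ]2∕3, 1[` of `stub_rates13HV` the threshold `β ∕ (4 + β)` lies in `]1∕7, 1∕5[` — far below `1∕2`. [folklore] -/
theorem threshold_T4_window {β : ℝ} (hβ1 : 2 / 3 < β) (hβ2 : β < 1) : 1 / 7 < β / (4 + β) ∧ β / (4 + β) < 1 / 5 := by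
  have h4 : (0 : ℝ) < 4 + β := by linarith
  constructor
  · rw [div_lt_div_iff₀ (by norm_num) h4]; linarith
  · rw [div_lt_div_iff₀ h4 (by norm_num)]; linarith

/-! ## §2 Polynomial moduli through FILE 4's iff -/

/-- the polynomial modulus `(j+1)^{−m}` is non-negative … [folklore] -/
theorem polyModulus_nonneg (m : ℝ) (j : ℕ) : 0 ≤ ((j : ℝ) + 1) ^ (-m) := Real.rpow_nonneg (by positivity) _

/-- … and at most one for `m ≥ 0`. [folklore] -/
theorem polyModulus_le_one {m : ℝ} (hm : 0 ≤ m) (j : ℕ) : ((j : ℝ) + 1) ^ (-m) ≤ 1 :=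
  Real.rpow_le_one_of_one_le_of_nonpos (by have : (0 : ℝ) ≤ j := Nat.cast_nonneg j; linarith) (by linarith)

/-- THE p-SERIES STEP: `Σ_j ((j+1)^{−m})^σ < ∞ ⟺ 1 < m·σ` (any real `σ`; Mathlib's `Real.summable_nat_rpow_inv` shifted by one). [folklore] -/
theorem rpowSummable_polyModulus_iff {m σ : ℝ} :
    Summable (fun j : ℕ => ((((j : ℝ) + 1) ^ (-m)) ^ σ)) ↔ 1 < m * σ := by
  have h : ∀ j : ℕ, (((j : ℝ) + 1) ^ (-m)) ^ σ = (((j : ℝ) + 1) ^ (m * σ))⁻¹ := by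
    intro j
    rw [← Real.rpow_mul (by positivity), neg_mul, Real.rpow_neg (by positivity)]
  simp_rw [h]
  have e : (fun j : ℕ => (((j : ℝ) + 1) ^ (m * σ))⁻¹) = fun j : ℕ => (fun n : ℕ => ((n : ℝ) ^ (m * σ))⁻¹) (j + 1) := by
    funext j; simp only [Nat.cast_add, Nat.cast_one]
  rw [e]
  exact (summable_nat_add_iff (f := fun n : ℕ => ((n : ℝ) ^ (m * σ))⁻¹) 1).trans Real.summable_nat_rpow_inv

/-- ★ **THE CROSSOVER AT A POLYNOMIAL MODULUS**: in the regime `0 < a < 1 < Λ`, the crossover of `r_j = (j+1)^{−m}` (`m ≥ 0`) is summable over the number of steps IFF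
`1 < m·σ⋆`, `σ⋆ = log(1∕a)∕log(Λ∕a)` — FILE 4's iff priced at polynomial decay. [folklore] -/
theorem summable_crossover_polyModulus_iff {a Λ m : ℝ} (ha0 : 0 < a) (ha1 : a < 1) (hΛ : 1 < Λ) (hm : 0 ≤ m) :
    Summable (fun K : ℕ => ∑ x ∈ antidiagonal K, min (a ^ x.2) (((x.1 : ℝ) + 1) ^ (-m) * Λ ^ x.2))
      ↔ 1 < m * (Real.log (1 / a) / Real.log (Λ / a)) := by
  rw [summable_crossover_iff_rpowSummable_threshold ha0 ha1 hΛ (fun j => polyModulus_nonneg m j) (fun j => polyModulus_le_one hm j)]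
  exact rpowSummable_polyModulus_iff

/-- A HARMONIC injected modulus `r_j = 1∕(j+1)` NEVER survives the crossover (`σ⋆ < 1`). [folklore] -/
theorem not_summable_crossover_harmonic {a Λ : ℝ} (ha0 : 0 < a) (ha1 : a < 1) (hΛ : 1 < Λ) :
    ¬ Summable (fun K : ℕ => ∑ x ∈ antidiagonal K, min (a ^ x.2) (((x.1 : ℝ) + 1) ^ (-(1 : ℝ)) * Λ ^ x.2)) := by
  rw [summable_crossover_polyModulus_iff ha0 ha1 hΛ zero_le_one, one_mul, not_lt]
  exact (threshold_lt_one ha0 ha1 hΛ).le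

/-- the inverse-square test in closed form: `1 < 2σ⋆ ⟺ a·Λ < 1`. [folklore] -/
theorem one_lt_two_mul_threshold_iff {a Λ : ℝ} (ha0 : 0 < a) (ha1 : a < 1) (hΛ : 1 < Λ) :
    1 < 2 * (Real.log (1 / a) / Real.log (Λ / a)) ↔ a * Λ < 1 := by
  have hΛ0 : 0 < Λ := one_pos.trans hΛ
  have hlog : 0 < Real.log (Λ / a) := Real.log_pos (by rw [lt_div_iff₀ ha0]; linarith)
  rw [← mul_div_assoc, lt_div_iff₀ hlog, one_mul, Real.log_div hΛ0.ne' ha0.ne', one_div, Real.log_inv]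
  rw [show Real.log Λ - Real.log a < 2 * -Real.log a ↔ Real.log a + Real.log Λ < 0 by constructor <;> intro h <;> linarith]
  rw [← Real.log_mul ha0.ne' hΛ0.ne', Real.log_neg_iff (mul_pos ha0 hΛ0)]

/-- An INVERSE-SQUARE injected modulus `r_j = 1∕(j+1)²` survives the crossover IFF `a·Λ < 1` (the contraction beats the multiplicity). [folklore] -/
theorem summable_crossover_invSq_iff {a Λ : ℝ} (ha0 : 0 < a) (ha1 : a < 1) (hΛ : 1 < Λ) :
    Summable (fun K : ℕ => ∑ x ∈ antidiagonal K, min (a ^ x.2) (((x.1 : ℝ) + 1) ^ (-(2 : ℝ)) * Λ ^ x.2)) ↔ a * Λ < 1 := by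
  rw [summable_crossover_polyModulus_iff ha0 ha1 hΛ (by norm_num : (0 : ℝ) ≤ 2)]
  exact one_lt_two_mul_threshold_iff ha0 ha1 hΛ

/-- COMPARISON, NEGATIVE SIDE: a modulus `0 ≤ r ≤ 1` bounded BELOW by `c·(j+1)^{−m}` (`c > 0`) with `m·σ⋆ ≤ 1` does NOT survive the crossover — every at-most-polynomially
decaying N17 letter of order `≤ 1∕σ⋆` is refused by the N19′ face through node U2. [folklore] -/
theorem not_summable_crossover_of_polyLower {a Λ m c : ℝ} {r : ℕ → ℝ} (ha0 : 0 < a) (ha1 : a < 1) (hΛ : 1 < Λ) (hc : 0 < c)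
    (hr0 : ∀ j, 0 ≤ r j) (hr1 : ∀ j, r j ≤ 1) (hlow : ∀ j : ℕ, c * ((j : ℝ) + 1) ^ (-m) ≤ r j)
    (hmσ : m * (Real.log (1 / a) / Real.log (Λ / a)) ≤ 1) :
    ¬ Summable (fun K : ℕ => ∑ x ∈ antidiagonal K, min (a ^ x.2) (r x.1 * Λ ^ x.2)) := by
  refine not_summable_crossover_of_not_rpowSummable_threshold ha0 ha1 hΛ hr0 hr1 fun hs => ?_
  set σ : ℝ := Real.log (1 / a) / Real.log (Λ / a) with hσdef
  have hσ : 0 < σ := threshold_pos ha0 ha1 hΛ.le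
  have hns : ¬ Summable (fun j : ℕ => ((((j : ℝ) + 1) ^ (-m)) ^ σ)) := by
    rw [rpowSummable_polyModulus_iff]; exact not_lt.mpr hmσ
  have hcσ : 0 < c ^ σ := Real.rpow_pos_of_pos hc _
  refine hns (Summable.of_nonneg_of_le (fun j => Real.rpow_nonneg (polyModulus_nonneg m j) _) (fun j => ?_) (hs.mul_left (c ^ σ)⁻¹))
  rw [le_inv_mul_iff₀ hcσ, ← Real.mul_rpow hc.le (polyModulus_nonneg m j)]
  exact Real.rpow_le_rpow (mul_nonneg hc.le (polyModulus_nonneg m j)) (hlow j) hσ.le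

/-- COMPARISON, POSITIVE SIDE: a modulus `0 ≤ r ≤ 1` bounded ABOVE by `C·(j+1)^{−m}` with `1 < m·σ⋆` survives the crossover. [folklore] -/
theorem summable_crossover_of_polyUpper {a Λ m C : ℝ} {r : ℕ → ℝ} (ha0 : 0 < a) (ha1 : a < 1) (hΛ : 1 < Λ) (hC : 0 ≤ C)
    (hr0 : ∀ j, 0 ≤ r j) (hr1 : ∀ j, r j ≤ 1) (hup : ∀ j : ℕ, r j ≤ C * ((j : ℝ) + 1) ^ (-m))
    (hmσ : 1 < m * (Real.log (1 / a) / Real.log (Λ / a))) :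
    Summable (fun K : ℕ => ∑ x ∈ antidiagonal K, min (a ^ x.2) (r x.1 * Λ ^ x.2)) := by
  refine summable_crossover_at_threshold ha0 ha1 hΛ hr0 hr1 ?_
  set σ : ℝ := Real.log (1 / a) / Real.log (Λ / a) with hσdef
  have hσ : 0 < σ := threshold_pos ha0 ha1 hΛ.le
  have hsum : Summable (fun j : ℕ => ((((j : ℝ) + 1) ^ (-m)) ^ σ)) := rpowSummable_polyModulus_iff.mpr hmσ
  refine Summable.of_nonneg_of_le (fun j => Real.rpow_nonneg (hr0 j) _) (fun j => ?_) (hsum.mul_left (C ^ σ))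
  calc r j ^ σ ≤ (C * ((j : ℝ) + 1) ^ (-m)) ^ σ := Real.rpow_le_rpow (hr0 j) (hup j) hσ.le
    _ = C ^ σ * (((j : ℝ) + 1) ^ (-m)) ^ σ := Real.mul_rpow hC (polyModulus_nonneg m j)

/-! ## §3 At `T4Crossover`'s bases `a = L^{−β}`, `Λ = L⁴` -/

/-- the bases are in the crossover regime: `0 < L^{−β} < 1 < L⁴` for `L > 1`, `β > 0`. [folklore] -/
theorem T4_bases_regime {L β : ℝ} (hL : 1 < L) (hβ : 0 < β) : 0 < L ^ (-β) ∧ L ^ (-β) < 1 ∧ (1 : ℝ) < L ^ (4 : ℕ) := by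
  have hL0 : 0 < L := one_pos.trans hL
  exact ⟨Real.rpow_pos_of_pos hL0 _, Real.rpow_lt_one_of_one_lt_of_neg hL (by linarith), one_lt_pow₀ hL (by norm_num)⟩

/-- at those bases contraction does NOT beat multiplicity: `a·Λ = L^{4−β} > 1` (`β < 4` suffices; the Hölder window has `β < 1`). [folklore] -/
theorem aΛ_T4_gt_one {L β : ℝ} (hL : 1 < L) (hβ4 : β < 4) : 1 < L ^ (-β) * L ^ (4 : ℕ) := by
  have hL0 : 0 < L := one_pos.trans hL
  rw [← Real.rpow_natCast L 4, ← Real.rpow_add hL0]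
  exact Real.one_lt_rpow hL (by push_cast; linarith)

/-- ★★ **THE N19′ CROSSOVER PRICE OF A POLYNOMIAL N17 LETTER, AT `T4Crossover`'s BASES**: the injected modulus `r_j = (j+1)^{−m}` (`m ≥ 0`) survives the crossover
`K ↦ Σ_{j+n=K} min(L^{−βn}, r_j L^{4n})` IFF `(4 + β) ∕ β < m` — a decay FASTER than `k^{−(4+β)∕β}`, exponent in `]5, 7[` on the Hölder window. [cite: Balaban1987RG1, (0.26) p.257] -/
theorem summable_crossover_polyModulus_T4_iff {L β m : ℝ} (hL : 1 < L) (hβ : 0 < β) (hm : 0 ≤ m) :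
    Summable (fun K : ℕ => ∑ x ∈ antidiagonal K, min ((L ^ (-β)) ^ x.2) (((x.1 : ℝ) + 1) ^ (-m) * (L ^ (4 : ℕ)) ^ x.2))
      ↔ (4 + β) / β < m := by
  obtain ⟨ha0, ha1, hΛ⟩ := T4_bases_regime hL hβ
  have h4 : (0 : ℝ) < 4 + β := by linarith
  rw [summable_crossover_polyModulus_iff ha0 ha1 hΛ hm, threshold_T4_bases β hL, ← mul_div_assoc, lt_div_iff₀ h4, div_lt_iff₀ hβ, one_mul]

/-- hence NO polynomial modulus of order `m ≤ 5` survives at `T4Crossover`'s bases on the Hölder window (`β < 1 ⇒ (4+β)∕β > 5`). [folklore] -/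
theorem not_summable_crossover_T4_of_le_five {L β m : ℝ} (hL : 1 < L) (hβ0 : 0 < β) (hβ1 : β < 1) (hm0 : 0 ≤ m) (hm : m ≤ 5) :
    ¬ Summable (fun K : ℕ => ∑ x ∈ antidiagonal K, min ((L ^ (-β)) ^ x.2) (((x.1 : ℝ) + 1) ^ (-m) * (L ^ (4 : ℕ)) ^ x.2)) := by
  rw [summable_crossover_polyModulus_T4_iff hL hβ0 hm0, not_lt, le_div_iff₀ hβ0]
  nlinarith

/-- in particular the INVERSE-SQUARE modulus (the TAILS of a `1∕k³` shift modulus, FILE 2's dictionary) does NOT survive at `T4Crossover`'s bases — equivalently (§2)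
`a·Λ = L^{4−β} > 1`. [folklore] -/
theorem not_summable_crossover_T4_invSq {L β : ℝ} (hL : 1 < L) (hβ0 : 0 < β) (hβ1 : β < 1) :
    ¬ Summable (fun K : ℕ => ∑ x ∈ antidiagonal K, min ((L ^ (-β)) ^ x.2) (((x.1 : ℝ) + 1) ^ (-(2 : ℝ)) * (L ^ (4 : ℕ)) ^ x.2)) :=
  not_summable_crossover_T4_of_le_five hL hβ0 hβ1 (by norm_num) (by norm_num)

/-- and the HARMONIC modulus (the order of CRIT-2's marginal-transport oscillation `≍ 1∕k`, FILE 7 `not_scaleShiftRate_transportToy`) does not survive at ANY bases. [folklore] -/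
theorem not_summable_crossover_T4_harmonic {L β : ℝ} (hL : 1 < L) (hβ0 : 0 < β) :
    ¬ Summable (fun K : ℕ => ∑ x ∈ antidiagonal K, min ((L ^ (-β)) ^ x.2) (((x.1 : ℝ) + 1) ^ (-(1 : ℝ)) * (L ^ (4 : ℕ)) ^ x.2)) := by
  obtain ⟨ha0, ha1, hΛ⟩ := T4_bases_regime hL hβ0
  exact not_summable_crossover_harmonic ha0 ha1 hΛ

end Summit.QuantumFields.YangMills.BalabanUVNodes.N17ShiftModulusCrossoverPolynomial

end
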